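import Summits.BirchSwinnertonDyer.BirchSwinnertonDyer.Theorems.EdixhovenFibreFiveSevenStarredOptimalManinUnitFiveSevenReceptacleKostersPannekoekShort
import HarnessLib

/-!
# The Kosters–Pannekoek receptacle on the K–P cells (`v₅(c₄) = 1` / `v₇(c₆) = 1`): `E₀(K)[p] = 0` and
# `log_ω(E₀(K)) = 𝒪_K` for the MINIMAL model of `W/ℚ` over an unramified `K ⊇ ℚ_p` of residue degree `n` with
# `gcd(n, p − 1) = 1`, off `c₄ ≡ −5 (mod 25)` / `c₆ ≡ 7 (mod 49)`

Route `EdixhovenFibreFiveSeven`, crux K★ `StarredOptimalManinUnitFiveSeven` (stmt-BirchSwinnertonDyer-22226), line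
`kato-lever`, seat `bsd-line-edix-p1` g5; `--supports` 22226 (helper; programme piece P2c of
`Cruxes/StarredOptimalManinUnitFiveSeven/Lines/kato-lever-F2-programme.md` §4/§7 — the receptacle of F″ =
`Literature.NumberTheory.EllipticCurves.kato_neron_isIntegral_twistedSymbolSum_of_additive_five_le` on the K–P cells, where
F″'s clause reads `gcd(ord_m p, p − 1) = 1 ∧ V(ℚ_p)[p] = 0`; used by the route's cruxes TDS57 22227 / KP57 23810).
TOOL theorems only (no definition, no named fact, no instance, no `sorry`); nothing closed or booked; BSD is not proved
by any of this.

* §1 `noPTorsion_of_variableChange` — `E₀(K)[p] = 0` TRANSPORTS along any `ℤ_p`-change of variables `D` with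
  `D • M = (y² = x³ + Ax + B)` (`E₀` by `hasNonsingularReduction_variableChange_some_iff`, `p • P = O` by
  `VariableChange.pointEquiv`) — the sibling `noPTorsion_of_norm_c₄_c₆_le` with its short-model input abstracted.
* §2 `noPTorsion_of_coprime` — for ANY `M/ℤ_p` (`p ∈ {5,7}`) with cuspidal reduction `‖Δ‖, ‖c₄‖ < 1`, `K/ℚ_p` finite
  unramified with residue field of order `p^n`, `gcd(n, p − 1) = 1`, and `c₄ ≢ −5 (mod 25)` (at `5`) /
  `c₆ ≢ 7 (mod 49)` (at `7`): `E₀(K)[p] = 0` (Mathlib's `toShortNF`: `c₄ = −48A`, `c₆ = −864B`;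
  `48A′ − 1 = 16(3A′ − 1) + 15`, `864B′ + 1 = 216(4B′ − 1) + 217`).
* §3 for `W/ℚ` globally minimal, `Addv W p`, `p ∈ {5,7}`, hypotheses on the INTEGER invariants
  `¬ 25 ∣ c₄(W_ℤ) + 5` / `¬ 49 ∣ c₆(W_ℤ) − 7`: `noPTorsion_of_addv_of_coprime` and the receptacle
  ★ `exists_mem_nonsingularReductionSubgroup_satLog_eq_of_addv_of_coprime` (`Λ̃ : E₀(K) ↠ 𝒪_K` for `W_ℤ ⊗ K`),
  `satLog_eq_zero_iff_of_addv_of_coprime`, `…padicLogPointFiniteExt…`, and the (S5b) trace form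
  `norm_trace_mul_le_one_of_forall_point_of_addv_of_coprime`.
The tree's `ℚ_p`-side dictionary `CuspTorsion.norm_c₄_add_or_norm_c₆_sub_of_prime_zsmul_eq_zero` says a `ℚ_p`-rational
`p`-torsion point FORCES `c₄ ≡ −5 (25)` / `c₆ ≡ 7 (49)`; the converse (Hensel), which turns F″'s `V(ℚ_p)[p] = 0` into the
residue hypothesis here, is not in the tree yet (recorded in the programme map §7).

References: [KostersPannekoek2017] arXiv:1703.07888, Thm. 1 (iii)–(iv), Cor. 2; [KimNakamura2020] Thm. 2.1, Cor. 2.4,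
Remark 1.8 (1); [SilvermanAEC2009] VII.1.3, VII.2.1, Exercise 3.7.
-/

set_option autoImplicit false
-- the Theorems namespace of a single-conjunct summit repeats the summit name by design (D-0017)
set_option linter.dupNamespace false

noncomputable section

open scoped Classical NNReal
open WeierstrassCurve Polynomial Literature.NumberTheory.EllipticCurves Literature.NumberTheory.EllipticCurves.FormalGroupChart
open Literature.NumberTheory.EllipticCurves.CuspJets
open Summit.BirchSwinnertonDyer.Rank1Residual.Additive
open Summit.BirchSwinnertonDyer.Rank1Residual.Additive.BallEval
open Summit.BirchSwinnertonDyer.BirchSwinnertonDyer.Theorems.KPort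
open Literature.NumberTheory.GaloisRepresentations.LubinTate (unitBall mem_unitBall_iff)

namespace Summit.BirchSwinnertonDyer.BirchSwinnertonDyer.Theorems.StarredOptimalManinUnitFiveSevenReceptacle

variable {p : ℕ} [hp : Fact p.Prime] {K : Type*} [NontriviallyNormedField K] [NormedAlgebra ℚ_[p] K]
  [IsUltrametricDist K]

/-! ## §1 `E₀(K)[p] = 0` transports along a `ℤ_p`-change of variables onto a short model -/

section Transport

variable {M : WeierstrassCurve ℤ_[p]} [hE : (M.map PadicInt.Coe.ringHom).IsElliptic]
  [hint : (curveK p K M).IsIntegral (NormedField.valuation (K := K)).integer]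

omit hE hint in
/-- **`E₀(K)[p] = 0` transports along a `ℤ_p`-change of variables** `D` with `D • M = (y² = x³ + Ax + B)`: `E₀(K)` is
preserved (`hasNonsingularReduction_variableChange_some_iff`, `D` is `𝒪_K`-integral) and so is `p • P = O`
(`VariableChange.pointEquiv`). [cite: SilvermanAEC2009, VII.1 Prop. 1.3(b) and VII.2 Prop. 2.1] -/
theorem noPTorsion_of_variableChange (D : VariableChange ℤ_[p]) {A B : ℤ_[p]} (hM : D • M = shortCurve A B)
    (hshort : ∀ Q : (curveK p K (shortCurve A B)).toAffine.Point,
      Q ∈ ((shortCurve A B).map (coeffHom p K)).nonsingularReductionSubgroup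
        (Valuation.integer.integers (NormedField.valuation (K := K))) → p • Q = 0 → Q = 0)
    {P : (curveK p K M).toAffine.Point}
    (hP : P ∈ (M.map (coeffHom p K)).nonsingularReductionSubgroup
      (Valuation.integer.integers (NormedField.valuation (K := K))))
    (hpP : p • P = 0) : P = 0 := by
  set f : ℤ_[p] →+* K := (unitBall K).subtype.comp (coeffHom p K) with hf
  have hcurve : (D.map f) • curveK p K M = curveK p K (shortCurve A B) := by
    rw [curveK, curveK, map_variableChange, hM]
  set e := VariableChange.pointEquiv (curveK p K M) (D.map f) with he
  rcases P with _ | ⟨x, y, h⟩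
  · rfl
  · exfalso
    have h' : (curveK p K (shortCurve A B)).toAffine.Nonsingular ((D.map f).toX x) ((D.map f).toY x y) := by
      rw [← hcurve]; exact (VariableChange.nonsingular_iff _ _ x y).mpr h
    have hQ : Affine.Point.congrEquiv hcurve (e (.some x y h)) = .some ((D.map f).toX x) ((D.map f).toY x y) h' := by
      rw [he, VariableChange.pointEquiv_some, Affine.Point.congrEquiv_some]
    have hV : (D.map (coeffHom p K)) • (M.map (coeffHom p K)) = (shortCurve A B).map (coeffHom p K) := by
      rw [map_variableChange, hM]
    have hfD : (D.map (coeffHom p K)).map (algebraMap (unitBall K) K) = D.map f := by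
      rw [VariableChange.map_map]; rfl
    have hQ0 : ((shortCurve A B).map (coeffHom p K)).HasNonsingularReduction
        (Affine.Point.some ((D.map f).toX x) ((D.map f).toY x y) h') :=
      (hasNonsingularReduction_variableChange_some_iff (Ω := K) (M.map (coeffHom p K))
        (D.map (coeffHom p K)) hV (by rw [hfD]) (by rw [hfD]) h h').mpr hP
    have hpQ : p • (Affine.Point.some ((D.map f).toX x) ((D.map f).toY x y) h' :
        (curveK p K (shortCurve A B)).toAffine.Point) = 0 := by
      rw [← hQ, ← map_nsmul, ← map_nsmul, hpP, map_zero, map_zero]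
    exact absurd (hshort _ hQ0 hpQ) (Affine.Point.some_ne_zero h')

/-! ## §2 Any cuspidal `M/ℤ_p`, `p ∈ {5,7}`, off `c₄ ≡ −5 (25)` / `c₆ ≡ 7 (49)`, `gcd(n, p−1) = 1`: `E₀(K)[p] = 0` -/

/-- `p ∣ 3A′ − 1 ⟹ p² ∣ c₄ + p` at `p = 5` for `c₄ = −48·(5A′)` (`48A′ − 1 = 16(3A′ − 1) + 15`). [folklore] -/
theorem sq_dvd_c₄_add_of_dvd (hp5 : p = 5) {A' c : ℤ_[p]} (hc : c = -48 * (p * A')) (h : (p : ℤ_[p]) ∣ 3 * A' - 1) :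
    (p : ℤ_[p]) ^ 2 ∣ c + p := by
  subst hp5
  obtain ⟨t, ht⟩ := h
  exact ⟨-(16 * t + 3), by rw [hc]; push_cast; linear_combination (-(16 : ℤ_[5]) * 5) * ht⟩

/-- `p ∣ 4B′ − 1 ⟹ p² ∣ c₆ − p` at `p = 7` for `c₆ = −864·(7B′)` (`864B′ + 1 = 216(4B′ − 1) + 217`). [folklore] -/
theorem sq_dvd_c₆_sub_of_dvd (hp7 : p = 7) {B' c : ℤ_[p]} (hc : c = -864 * (p * B')) (h : (p : ℤ_[p]) ∣ 4 * B' - 1) :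
    (p : ℤ_[p]) ^ 2 ∣ c - p := by
  subst hp7
  obtain ⟨t, ht⟩ := h
  exact ⟨-(216 * t + 31), by rw [hc]; push_cast; linear_combination (-(216 : ℤ_[7]) * 7) * ht⟩

/-- **`E₀(K)[p] = 0` on the Kosters–Pannekoek cells, any model.** `M/ℤ_p` with cuspidal reduction (`‖Δ‖, ‖c₄‖ < 1`),
`p ∈ {5, 7}`, `K/ℚ_p` finite UNRAMIFIED with residue field of order `p^n`, `gcd(n, p − 1) = 1`, and
`p² ∤ c₄ + p` (at `5`: `c₄ ≢ −5 (25)`) / `p² ∤ c₆ − p` (at `7`: `c₆ ≢ 7 (49)`): every `P ∈ E₀(K)` with `p • P = O` is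
`O`. Mathlib's `toShortNF` (`u = 1`) + §1 + the sibling `noPTorsion_short_of_coprime`.
[cite: KostersPannekoek2017, Thm. 1 (iii)-(iv) and Cor. 2] [cite: SilvermanAEC2009, VII.1 Prop. 1.3] -/
theorem noPTorsion_of_coprime [FiniteDimensional ℚ_[p] K] (hp57 : p = 5 ∨ p = 7)
    (hK : ∀ z : K, ‖z‖ < 1 → ‖z‖ ≤ ‖(p : K)‖) {n : ℕ}
    (hcard : Nat.card (IsLocalRing.ResidueField (unitBall K)) = p ^ n) (hn : n.Coprime (p - 1))
    (hΔ : ‖M.Δ‖ < 1) (hc₄ : ‖M.c₄‖ < 1)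
    (hne5 : p = 5 → ¬ (p : ℤ_[p]) ^ 2 ∣ M.c₄ + p) (hne7 : p = 7 → ¬ (p : ℤ_[p]) ^ 2 ∣ M.c₆ - p)
    {P : (curveK p K M).toAffine.Point}
    (hP : P ∈ (M.map (coeffHom p K)).nonsingularReductionSubgroup
      (Valuation.integer.integers (NormedField.valuation (K := K))))
    (hpP : p • P = 0) : P = 0 := by
  have hp5 : 5 ≤ p := by rcases hp57 with rfl | rfl <;> norm_num
  obtain ⟨h2, h3⟩ := norm_two_three (p := p) hp5
  haveI : Invertible (2 : ℤ_[p]) := (PadicInt.isUnit_iff.mpr h2).invertible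
  haveI : Invertible (3 : ℤ_[p]) := (PadicInt.isUnit_iff.mpr h3).invertible
  set D : VariableChange ℤ_[p] := M.toShortNF with hD
  have hDu : D.u = 1 := toShortNF_u M
  haveI hNF : (D • M).IsShortNF := WeierstrassCurve.toShortNF_spec M
  set A := (D • M).a₄ with hA'
  set B := (D • M).a₆ with hB'
  have hM : D • M = shortCurve A B := WeierstrassCurve.ext hNF.a₁ hNF.a₂ hNF.a₃ rfl rfl
  have ec₄ : (shortCurve A B).c₄ = M.c₄ := by
    rw [← hM, variableChange_c₄, hDu, inv_one, Units.val_one, one_pow, one_mul]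
  have ec₆ : (shortCurve A B).c₆ = M.c₆ := by
    rw [← hM, variableChange_c₆, hDu, inv_one, Units.val_one, one_pow, one_mul]
  have eΔ : (shortCurve A B).Δ = M.Δ := by
    rw [← hM, variableChange_Δ, hDu, inv_one, Units.val_one, one_pow, one_mul]
  -- `A, B ∈ pℤ_p`
  obtain ⟨hA1, hB1⟩ := norm_lt_one_of_short (p := p) hp5 (by rw [ec₄]; exact hc₄) (by rw [eΔ]; exact hΔ)
  obtain ⟨A', hA⟩ : (p : ℤ_[p]) ∣ A := (PadicInt.norm_lt_one_iff_dvd A).mp hA1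
  obtain ⟨B', hB⟩ : (p : ℤ_[p]) ∣ B := (PadicInt.norm_lt_one_iff_dvd B).mp hB1
  -- the residue hypotheses in short-model form
  have hne5' : p = 5 → ¬ (p : ℤ_[p]) ∣ 3 * A' - 1 := fun h5 hd =>
    hne5 h5 (sq_dvd_c₄_add_of_dvd h5 (by rw [← ec₄, (shortCurve_c₄_Δ A B).1, hA]) hd)
  have hne7' : p = 7 → ¬ (p : ℤ_[p]) ∣ 4 * B' - 1 := fun h7 hd =>
    hne7 h7 (sq_dvd_c₆_sub_of_dvd h7 (by rw [← ec₆, CuspTorsion.shortCurve_c₆ A B, hB]) hd)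
  -- ellipticity / integrality of the short model, and §1
  haveI hE' : ((shortCurve A B).map PadicInt.Coe.ringHom).IsElliptic := by
    rw [← hM, ← map_variableChange]; infer_instance
  haveI : (curveK p K (shortCurve A B)).IsIntegral (NormedField.valuation (K := K)).integer :=
    isIntegral_curveK p K (shortCurve A B)
  exact noPTorsion_of_variableChange D hM
    (fun Q hQ hpQ => noPTorsion_short_of_coprime hp57 hK hcard hn hA hB hne5' hne7' hQ hpQ) hP hpP

end Transport

/-! ## §3 `W/ℚ` globally minimal at an additive `p ∈ {5,7}` off `c₄ ≡ −5 (25)` / `c₆ ≡ 7 (49)`: the receptacle -/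

section Rat

variable [CompleteSpace K] (W : WeierstrassCurve ℚ) [W.IsElliptic] [W.IsGloballyMinimal]
  [(curveK p K ((integralModelInt W).map (Int.castRingHom ℤ_[p]))).IsIntegral
    (NormedField.valuation (K := K)).integer]

omit [NontriviallyNormedField K] [NormedAlgebra ℚ_[p] K] [IsUltrametricDist K] [CompleteSpace K] in
/-- `p² ∣ (z : ℤ_p) ⟹ p² ∣ z` for an integer `z`. [folklore] -/
theorem int_sq_dvd_of_padicInt_sq_dvd {z : ℤ} (h : (p : ℤ_[p]) ^ 2 ∣ (z : ℤ_[p])) : ((p : ℤ) ^ 2) ∣ z := by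
  have hmem : (z : ℤ_[p]) ∈ Ideal.span {(p : ℤ_[p]) ^ 2} := Ideal.mem_span_singleton.mpr h
  rw [← PadicInt.norm_le_pow_iff_mem_span_pow] at hmem
  exact_mod_cast (PadicInt.norm_int_le_pow_iff_dvd (p := p) (k := z) (n := 2)).mp hmem

omit [CompleteSpace K] in
/-- **`E₀(K)[p] = 0` for the minimal model of `W/ℚ`** at an additive `p ∈ {5,7}` with `¬ 25 ∣ c₄ + 5` (at `5`) /
`¬ 49 ∣ c₆ − 7` (at `7`) on the integer invariants of `W_ℤ`, over every finite unramified `K ⊇ ℚ_p` whose residue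
degree `n` has `gcd(n, p − 1) = 1`. [cite: KostersPannekoek2017, Thm. 1 (iii)-(iv) and Cor. 2] -/
theorem noPTorsion_of_addv_of_coprime [FiniteDimensional ℚ_[p] K] (hp57 : p = 5 ∨ p = 7)
    (hadd : Rank1Residual.Addv W p) (hK : ∀ z : K, ‖z‖ < 1 → ‖z‖ ≤ ‖(p : K)‖) {n : ℕ}
    (hcard : Nat.card (IsLocalRing.ResidueField (unitBall K)) = p ^ n) (hn : n.Coprime (p - 1))
    (hne5 : p = 5 → ¬ ((p : ℤ) ^ 2) ∣ (integralModelInt W).c₄ + p)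
    (hne7 : p = 7 → ¬ ((p : ℤ) ^ 2) ∣ (integralModelInt W).c₆ - p)
    {P : (curveK p K ((integralModelInt W).map (Int.castRingHom ℤ_[p]))).toAffine.Point}
    (hP : P ∈ (((integralModelInt W).map (Int.castRingHom ℤ_[p])).map (coeffHom p K)).nonsingularReductionSubgroup
      (Valuation.integer.integers (NormedField.valuation (K := K))))
    (hpP : p • P = 0) : P = 0 := by
  haveI := isElliptic_map_integralModelInt_padic (p := p) W
  obtain ⟨hΔ, hc₄⟩ := norm_Δ_lt_one_of_addv (p := p) W hadd
  refine noPTorsion_of_coprime hp57 hK hcard hn hΔ hc₄ (fun h5 hd => hne5 h5 ?_) (fun h7 hd => hne7 h7 ?_) hP hpP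
  · rw [map_c₄, eq_intCast] at hd
    exact int_sq_dvd_of_padicInt_sq_dvd (p := p) (by exact_mod_cast hd)
  · rw [map_c₆, eq_intCast] at hd
    exact int_sq_dvd_of_padicInt_sq_dvd (p := p) (by exact_mod_cast hd)

/-- ★ **THE RECEPTACLE ON THE KOSTERS–PANNEKOEK CELLS.** `W/ℚ` globally minimal, `p ∈ {5, 7}` additive for `W` with
`¬ 25 ∣ c₄(W_ℤ) + 5` (at `5`) / `¬ 49 ∣ c₆(W_ℤ) − 7` (at `7`), `K/ℚ_p` finite UNRAMIFIED with residue field of order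
`p^n`, `gcd(n, p − 1) = 1` (e.g. `K = ℚ(ζ_m)_v`, `n = ord_m p`, as in F″'s clause): `Λ̃ : E₀(K) ↠ 𝒪_K` for the minimal
model `W_ℤ ⊗ K` — Kim–Nakamura Cor. 2.4 (log side) off the Kosters–Pannekoek exception.
[cite: KimNakamura2020, Thm. 2.1 and Cor. 2.4, Remark 1.8 (1)] [cite: KostersPannekoek2017, Thm. 1 and Cor. 2] -/
theorem exists_mem_nonsingularReductionSubgroup_satLog_eq_of_addv_of_coprime [FiniteDimensional ℚ_[p] K]
    (hp57 : p = 5 ∨ p = 7) (hadd : Rank1Residual.Addv W p) (hK : ∀ z : K, ‖z‖ < 1 → ‖z‖ ≤ ‖(p : K)‖) {n : ℕ}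
    (hcard : Nat.card (IsLocalRing.ResidueField (unitBall K)) = p ^ n) (hn : n.Coprime (p - 1))
    (hne5 : p = 5 → ¬ ((p : ℤ) ^ 2) ∣ (integralModelInt W).c₄ + p)
    (hne7 : p = 7 → ¬ ((p : ℤ) ^ 2) ∣ (integralModelInt W).c₆ - p) {y : K} (hy : ‖y‖ ≤ 1) :
    ∃ P ∈ (((integralModelInt W).map (Int.castRingHom ℤ_[p])).map (coeffHom p K)).nonsingularReductionSubgroup
        (Valuation.integer.integers (NormedField.valuation (K := K))),
      satLog p K ((integralModelInt W).map (Int.castRingHom ℤ_[p])) P = y := by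
  have hp2 : p ≠ 2 := by rcases hp57 with rfl | rfl <;> norm_num
  haveI := isElliptic_map_integralModelInt_padic (p := p) W
  obtain ⟨hΔ, hc₄⟩ := norm_Δ_lt_one_of_addv (p := p) W hadd
  exact exists_mem_nonsingularReductionSubgroup_satLog_eq hp2 hK hΔ hc₄
    (fun P hP hpP => noPTorsion_of_addv_of_coprime W hp57 hadd hK hcard hn hne5 hne7 hP hpP) hy

/-- `Λ̃` is injective on `E₀(K)` for the minimal model (same hypotheses). [cite: SilvermanAEC2009, VII.2 Prop. 2.1 and Thm. IV.6.4] -/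
theorem satLog_eq_zero_iff_of_addv_of_coprime [FiniteDimensional ℚ_[p] K] (hp57 : p = 5 ∨ p = 7)
    (hadd : Rank1Residual.Addv W p) (hK : ∀ z : K, ‖z‖ < 1 → ‖z‖ ≤ ‖(p : K)‖) {n : ℕ}
    (hcard : Nat.card (IsLocalRing.ResidueField (unitBall K)) = p ^ n) (hn : n.Coprime (p - 1))
    (hne5 : p = 5 → ¬ ((p : ℤ) ^ 2) ∣ (integralModelInt W).c₄ + p)
    (hne7 : p = 7 → ¬ ((p : ℤ) ^ 2) ∣ (integralModelInt W).c₆ - p)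
    {P : (curveK p K ((integralModelInt W).map (Int.castRingHom ℤ_[p]))).toAffine.Point}
    (hP : P ∈ (((integralModelInt W).map (Int.castRingHom ℤ_[p])).map (coeffHom p K)).nonsingularReductionSubgroup
      (Valuation.integer.integers (NormedField.valuation (K := K)))) :
    satLog p K ((integralModelInt W).map (Int.castRingHom ℤ_[p])) P = 0 ↔ P = 0 := by
  have hp2 : p ≠ 2 := by rcases hp57 with rfl | rfl <;> norm_num
  haveI := isElliptic_map_integralModelInt_padic (p := p) W
  obtain ⟨hΔ, hc₄⟩ := norm_Δ_lt_one_of_addv (p := p) W hadd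
  exact satLog_eq_zero_iff_of_mem_nonsingularReductionSubgroup hp2 hK hΔ hc₄
    (fun P hP hpP => noPTorsion_of_addv_of_coprime W hp57 hadd hK hcard hn hne5 hne7 hP hpP) hP

/-- The same receptacle in (S5b)'s currency: every `y ∈ 𝒪_K` is `padicLogPointFiniteExt ‖·‖ E p P` for some
`P ∈ E₀(K)` of the minimal model. [cite: KimNakamura2020, Cor. 2.4] [cite: SilvermanAEC2009, Thm. IV.6.4 with Prop. VII.2.2] -/
theorem exists_mem_nonsingularReductionSubgroup_padicLogPointFiniteExt_eq_of_addv_of_coprime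
    [FiniteDimensional ℚ_[p] K] (hp57 : p = 5 ∨ p = 7) (hadd : Rank1Residual.Addv W p)
    (hK : ∀ z : K, ‖z‖ < 1 → ‖z‖ ≤ ‖(p : K)‖) {n : ℕ}
    (hcard : Nat.card (IsLocalRing.ResidueField (unitBall K)) = p ^ n) (hn : n.Coprime (p - 1))
    (hne5 : p = 5 → ¬ ((p : ℤ) ^ 2) ∣ (integralModelInt W).c₄ + p)
    (hne7 : p = 7 → ¬ ((p : ℤ) ^ 2) ∣ (integralModelInt W).c₆ - p) {y : K} (hy : ‖y‖ ≤ 1) :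
    ∃ P ∈ (((integralModelInt W).map (Int.castRingHom ℤ_[p])).map (coeffHom p K)).nonsingularReductionSubgroup
        (Valuation.integer.integers (NormedField.valuation (K := K))),
      padicLogPointFiniteExt (NormedField.valuation (K := K))
        (curveK p K ((integralModelInt W).map (Int.castRingHom ℤ_[p]))) p P = y := by
  have hp2 : p ≠ 2 := by rcases hp57 with rfl | rfl <;> norm_num
  haveI := isElliptic_map_integralModelInt_padic (p := p) W
  obtain ⟨hΔ, hc₄⟩ := norm_Δ_lt_one_of_addv (p := p) W hadd
  exact exists_mem_nonsingularReductionSubgroup_padicLogPointFiniteExt_eq hp2 hK hΔ hc₄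
    (fun P hP hpP => noPTorsion_of_addv_of_coprime W hp57 hadd hK hcard hn hne5 hne7 hP hpP) hy

/-- ★ **The (S5b) trace form on the Kosters–Pannekoek cells** (same hypotheses): if `‖Tr_{K/ℚ_p}(a · log_ω P)‖ ≤ 1`
for every `P ∈ E(K)` of the minimal model `W_ℤ ⊗ K` then `‖Tr_{K/ℚ_p}(a · o)‖ ≤ 1` for every `o ∈ 𝒪_K`:
`exp*_ω(H¹(K_v, T_pE)) ⊆ 𝒪_v^∨ (= 𝒪_v)` — the receptacle of F″ off the K–P exception, in the currency of
`PAdicHodge.exists_smul_range_expStarCoord_iff_trace_log`. [cite: KimNakamura2020, Thm. 2.1 and Cor. 2.4] -/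
theorem norm_trace_mul_le_one_of_forall_point_of_addv_of_coprime [FiniteDimensional ℚ_[p] K]
    (hp57 : p = 5 ∨ p = 7) (hadd : Rank1Residual.Addv W p) (hK : ∀ z : K, ‖z‖ < 1 → ‖z‖ ≤ ‖(p : K)‖) {n : ℕ}
    (hcard : Nat.card (IsLocalRing.ResidueField (unitBall K)) = p ^ n) (hn : n.Coprime (p - 1))
    (hne5 : p = 5 → ¬ ((p : ℤ) ^ 2) ∣ (integralModelInt W).c₄ + p)
    (hne7 : p = 7 → ¬ ((p : ℤ) ^ 2) ∣ (integralModelInt W).c₆ - p) {a : K}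
    (ha : ∀ P : (curveK p K ((integralModelInt W).map (Int.castRingHom ℤ_[p]))).toAffine.Point,
      ‖Algebra.trace ℚ_[p] K (a * padicLogPointFiniteExt (NormedField.valuation (K := K))
        (curveK p K ((integralModelInt W).map (Int.castRingHom ℤ_[p]))) p P)‖ ≤ 1)
    {o : K} (ho : ‖o‖ ≤ 1) : ‖Algebra.trace ℚ_[p] K (a * o)‖ ≤ 1 := by
  have hp2 : p ≠ 2 := by rcases hp57 with rfl | rfl <;> norm_num
  haveI := isElliptic_map_integralModelInt_padic (p := p) W
  obtain ⟨hΔ, hc₄⟩ := norm_Δ_lt_one_of_addv (p := p) W hadd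
  exact norm_trace_mul_le_one_of_forall_point hp2 hK hΔ hc₄
    (fun P hP hpP => noPTorsion_of_addv_of_coprime W hp57 hadd hK hcard hn hne5 hne7 hP hpP) ha ho

end Rat

end Summit.BirchSwinnertonDyer.BirchSwinnertonDyer.Theorems.StarredOptimalManinUnitFiveSevenReceptacle

end
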